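import Literature.MathematicalPhysics.StatisticalMechanics.BarlowCovering
import Summits.Ventures.Crystal3D.Theorems.StickyWulffConstantTextureLiminfTexShadowCertificateDefs
import HarnessLib

/-!
# TB-1 brick: LOCAL SLAB SEALING — in a laterally BOUNDED region of complete layers of a moved Barlow stacking there is no room for any other ball
# (lane T, crux `TextureLiminfV5`, stmt-Ventures-23912; memo HOME/wulff-p2/g25/SLAB-PLATES-g25.md §6 (5))

HONEST FRAMING. Venture `Summits/Ventures/Crystal3D` (cell `crystal3d-full`), route `route-Ventures-StickyWulffConstant`, helper `--supports` the
law-v5 crux `TextureLiminfV5` (stmt-Ventures-23912).  Corollary (census-free, standard axioms) of the Literature covering lemma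
`exists_barlowPos_slab_dist_sq_le_half` ('…BarlowCovering'), localising its `eq_movedBarlowPos_of_slab_complete` (which asks for laterally UNBOUNDED complete
layers) to a complete CYLINDER.  No cover is built; F-C1 not moved.

WHY.  The descent ('…TextureBuildLayerDescentFrame' `descentPropagation`) certifies that every SITE of the near-wall presentation `stacking L b s` in a
bounded column is a ball.  The plate step's defect count (COL) also needs the converse there: every BALL of the column is a site — then the column holds no
`S`-defect at all (no vacant site, no off-`S` ball) and the pigeonhole of '…SlabPlates' runs over the genuinely defective material only.  A `1`-separated set
containing every site of the layers `k … m` within frame distance `ρ` of a frame point `p₀` contains no other point whose frame height lies in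
`[k√(2/3), m√(2/3)]` and whose frame distance to `p₀` is `≤ ρ − 1`: the nearest site of those layers is within `1/√2 < 1`.

* `dist_moved_eq'` — `dist q (A p + t) = dist (A⁻¹(q − t)) p`;
* **`eq_movedBarlowPos_of_slab_complete_local`** — the statement above (frame `p ↦ A p + t`, any Hägg-or-not word `s`);
* **`eq_site_of_stacking_complete_local`** — the same for the tree's `stacking L b s` (sites `L (barlowPos 1 √(2/3) s k i j) + b`), in the output shape of
  `descentPropagation` / `slabPropagation`.
-/

noncomputable section

namespace Summit.Ventures.Crystal3D.Theorems

open Literature.MathematicalPhysics.StatisticalMechanics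
open Summit.Ventures.Crystal3D.Cruxes.TextureLiminf.TexShadow (stacking)

/-- Distances to a moved site: `dist q (A p + t) = dist (A⁻¹ (q − t)) p`. -/
theorem dist_moved_eq' (A : EuclideanSpace ℝ (Fin 3) ≃ₗᵢ[ℝ] EuclideanSpace ℝ (Fin 3)) (t q p : EuclideanSpace ℝ (Fin 3)) :
    dist q (A p + t) = dist (A.symm (q - t)) p := by
  have e : dist (A.symm (q - t)) p = dist (q - t) (A p) := by
    conv_lhs => rw [show p = A.symm (A p) by simp]
    exact A.symm.dist_map _ _
  rw [e, dist_eq_norm, dist_eq_norm]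
  congr 1
  abel

/-- **LOCAL SLAB SEALING.**  `X` `1`-separated; every site of the layers `k, …, m` (`k ≤ m`) of the moved ideal stacking `A·(barlowStacking 1 √(2/3) s) + t`
whose frame position is within `ρ` of the frame point `p₀` lies in `X`.  Then every point of `X` with frame height in `[k√(2/3), m√(2/3)]` and frame distance
`≤ ρ − 1` to `p₀` IS one of those sites. -/
theorem eq_movedBarlowPos_of_slab_complete_local (s : ℤ → ℤ)
    (A : EuclideanSpace ℝ (Fin 3) ≃ₗᵢ[ℝ] EuclideanSpace ℝ (Fin 3)) (t : EuclideanSpace ℝ (Fin 3))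
    {X : Set (EuclideanSpace ℝ (Fin 3))} (hsep : ∀ x ∈ X, ∀ y ∈ X, x ≠ y → 1 ≤ dist x y)
    {k m : ℤ} (hkm : k ≤ m) (p₀ : EuclideanSpace ℝ (Fin 3)) (ρ : ℝ)
    (hcomplete : ∀ k' i j : ℤ, k ≤ k' → k' ≤ m → dist (barlowPos 1 (Real.sqrt (2 / 3)) s k' i j) p₀ ≤ ρ →
      A (barlowPos 1 (Real.sqrt (2 / 3)) s k' i j) + t ∈ X)
    {q : EuclideanSpace ℝ (Fin 3)} (hq : q ∈ X) (hk : k * Real.sqrt (2 / 3) ≤ (A.symm (q - t)) 2)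
    (hm : (A.symm (q - t)) 2 ≤ m * Real.sqrt (2 / 3)) (hρ : dist (A.symm (q - t)) p₀ ≤ ρ - 1) :
    ∃ k' i j : ℤ, k ≤ k' ∧ k' ≤ m ∧ q = A (barlowPos 1 (Real.sqrt (2 / 3)) s k' i j) + t := by
  obtain ⟨k', i, j, h1, h2, hd⟩ := exists_barlowPos_slab_dist_sq_le_half s hkm (A.symm (q - t)) hk hm
  set p := barlowPos 1 (Real.sqrt (2 / 3)) s k' i j with hp
  have hd1 : dist (A.symm (q - t)) p < 1 := by
    nlinarith [dist_nonneg (x := A.symm (q - t)) (y := p)]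
  have hpρ : dist p p₀ ≤ ρ := by
    have := dist_triangle p (A.symm (q - t)) p₀
    rw [dist_comm p (A.symm (q - t))] at this
    linarith
  refine ⟨k', i, j, h1, h2, ?_⟩
  by_contra hne
  have h1le := hsep q hq _ (hcomplete k' i j h1 h2 hpρ) hne
  rw [dist_moved_eq'] at h1le
  linarith

/-- **LOCAL SLAB SEALING for `stacking L b s`** (the output shape of `descentPropagation` / `slabPropagation`): if every site `L (barlowPos 1 √(2/3) s k' i j) + b`
with `k ≤ k' ≤ m` and frame position within `ρ` of `p₀` is a ball of the unit packing `x`, then every ball with frame height in `[k√(2/3), m√(2/3)]` and frame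
distance `≤ ρ − 1` to `p₀` is such a site — in particular it lies on `stacking L b s`. -/
theorem eq_site_of_stacking_complete_local {N : ℕ} {x : Fin N → EuclideanSpace ℝ (Fin 3)} (hx : IsUnitPacking x) (s : ℤ → ℤ)
    (L : EuclideanSpace ℝ (Fin 3) ≃ₗᵢ[ℝ] EuclideanSpace ℝ (Fin 3)) (b : EuclideanSpace ℝ (Fin 3))
    {k m : ℤ} (hkm : k ≤ m) (p₀ : EuclideanSpace ℝ (Fin 3)) (ρ : ℝ)
    (hcomplete : ∀ k' i j : ℤ, k ≤ k' → k' ≤ m → dist (barlowPos 1 (Real.sqrt (2 / 3)) s k' i j) p₀ ≤ ρ →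
      L (barlowPos 1 (Real.sqrt (2 / 3)) s k' i j) + b ∈ Set.range x)
    (c : Fin N) (hk : k * Real.sqrt (2 / 3) ≤ (L.symm (x c - b)) 2) (hm : (L.symm (x c - b)) 2 ≤ m * Real.sqrt (2 / 3))
    (hρ : dist (L.symm (x c - b)) p₀ ≤ ρ - 1) :
    (∃ k' i j : ℤ, k ≤ k' ∧ k' ≤ m ∧ x c = L (barlowPos 1 (Real.sqrt (2 / 3)) s k' i j) + b) ∧ x c ∈ stacking L b s := by
  have hsep : ∀ p ∈ Set.range x, ∀ q ∈ Set.range x, p ≠ q → 1 ≤ dist p q := by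
    rintro p ⟨i, rfl⟩ q ⟨j, rfl⟩ hne
    exact hx (fun h => hne (by rw [h]))
  obtain ⟨k', i, j, h1, h2, he⟩ :=
    eq_movedBarlowPos_of_slab_complete_local s L b hsep hkm p₀ ρ hcomplete ⟨c, rfl⟩ hk hm hρ
  exact ⟨⟨k', i, j, h1, h2, he⟩, ⟨barlowPos 1 (Real.sqrt (2 / 3)) s k' i j, ⟨k', i, j, rfl⟩, he.symm⟩⟩

end Summit.Ventures.Crystal3D.Theorems

end
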